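import Mathlib
import Summits.NavierStokesRegularity.NavierStokesRegularity.Theorems.LerayQuarterDissipationFiniteDissipationLiouvilleWindowSocket
import Summits.NavierStokesRegularity.NavierStokesRegularity.Theorems.LerayQuarterDissipationFiniteDissipationLiouvilleLocalBalanceApex
import Literature.Analysis.FluidPDE.SpaceTimeCalculus
import Literature.Analysis.FluidPDE.EnergyToolkit
import HarnessLib

/-!
# Crux `FiniteDissipationLiouville` (stmt-NavierStokesRegularity-22144): THE LOCAL PRODUCTION EXCESS
# AND THE SUPER-SELF-SIMILAR SPEED RECUR WITH BOUNDED GAPS AND FILL A DEFINITE PARABOLIC VOLUME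

Theorems file of route `LerayQuarterDissipation` (lead prover g19; `--supports` the crux; first
instances of `…WindowSocket`). Navier–Stokes regularity is NOT proved by anything here; no summit is.

Lead g18 (`…LocalBalanceApex`): a KNSS-gauge Type-I field with a Type-I envelope whose Lamb-form
local enstrophy balance `⟪u, ω × curl ω⟫ ≤ ‖curl ω‖² + ‖ω‖²/(4(−t))` holds on a final slab
`[τ, 0) × ℝ³` is not singular at the apex; so the balance fails at points ACCUMULATING at the apex
of a singular member. Feeding this apex criterion to the window socket of `…WindowSocket`:

* bookkeeping: joint continuity of `u`, `curl u`, `curl curl u` on the open past for members of the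
  class (`isSmoothSpaceTimeOn_curl`, `isSmoothSpaceTimeOn_curl_curl`), pointwise scale covariance of
  the balance (`localBalance_at_nsRescale`), violations pass from KNSS limits to the approximants
  (`localBalance_violation_eventually`), the violation set is open (`isOpen_localBalance_violation`);
* **`localBalance_excess_in_every_window`** — for every `A` there is ONE `ε = ε(A) ∈ (0,1)` such that
  every SINGULAR KNSS-gauge Type-I field (`IsTypeIAncientMild C V`, `C ≤ A`) with a Type-I envelope
  `HasTypeIDecay A V` has, in EVERY backward window `[−c², −εc²]` (`c > 0`), a point where
  `‖curl ω‖² + ‖ω‖²/(4(−t)) < ⟪u, ω × curl ω⟫`: the local Lamb-form production excess RECURS WITH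
  BOUNDED GAPS in logarithmic time, at every scale — down to the apex and back to `t → −∞`;
* **`localBalance_excess_volume`** — there are `ε(A) ∈ (0,1)`, `η(A) > 0` such that the excess set of
  every such singular field meets the unit window `[−1, −ε] × ℝ³` in space–time volume `≥ η` (by
  scale invariance of the class: volume `≥ η c⁵` in the window `[−c², −εc²]`, in rescaled units);
* pointwise order `speed ≤ 1 ⇒ product bound ⇒ Lamb balance` (`lambProduct_at_of_speed_le_one`,
  `localBalance_at_of_lambProduct`), hence the COROLLARIES with the same `ε`, `η`:
  **`speed_exceeds_one_in_every_window`** / **`speed_exceeds_one_volume`** — THE FAST SET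
  `{√(−t)‖u‖ > 1}` OF A SINGULAR ENVELOPED MEMBER IS NEVER EMPTY FOR MORE THAN `|log ε(A)|` e-FOLDS
  OF BACKWARD TIME AND FILLS A DEFINITE VOLUME OF EVERY UNIT WINDOW; `lambProduct_excess_in_every_window`,
  `crossFlow_excess_in_every_window` likewise.

HONEST FRAMING. Ineffective constants (contradiction + compactness); statements about a HYPOTHETICAL
singular enveloped field (e.g. the critical element of the crux, which is enveloped by `…Envelope`);
for the scaling-recurrent critical element bounded gaps also follow from recurrence, but `ε(A)`,
`η(A)` are uniform over the class and the volume floor is new. Nothing is removed from the DSS wall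
(`∀ c>1 TypeIDSSLiouville c`, NECESSARY for the crux). Nothing here bears on NS regularity.

References: Koch–Nadirashvili–Seregin–Šverák, Acta Math. 203 (2009) §4; folklore.
-/

noncomputable section

set_option linter.dupNamespace false

namespace Summit.NavierStokesRegularity.NavierStokesRegularity.Theorems.FiniteDissipationLiouville.WindowRecurrence

open MeasureTheory Set Filter Topology Metric InnerProductSpace Function Real
open scoped RealInnerProductSpace ContDiff ENNReal
open Literature.Analysis Literature.Analysis.FluidPDE
open Summit.NavierStokesRegularity.NavierStokesRegularity.Theorems
open Summit.NavierStokesRegularity.NavierStokesRegularity.Theorems.RecurrentReductionD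
open Summit.NavierStokesRegularity.NavierStokesRegularity.Theorems.FiniteDissipationLiouville
open Summit.NavierStokesRegularity.NavierStokesRegularity.Theorems.FiniteDissipationLiouville.CrossFlow
open Summit.NavierStokesRegularity.NavierStokesRegularity.Theorems.FiniteDissipationLiouville.EndpointScheme
open Summit.NavierStokesRegularity.NavierStokesRegularity.Theorems.FiniteDissipationLiouville.LambProduct
open Summit.NavierStokesRegularity.NavierStokesRegularity.Theorems.FiniteDissipationLiouville.LocalBalance
open Summit.NavierStokesRegularity.NavierStokesRegularity.Theorems.FiniteDissipationLiouville.WindowSocket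

variable {C : ℝ} {V : ℝ → EuclideanSpace ℝ (Fin 3) → EuclideanSpace ℝ (Fin 3)}

/-! ### Joint continuity of the jet on the open past -/

section Continuity

/-- The vorticity `(t,x) ↦ curl (V t) x` of a member of the class is jointly smooth on the open past.
[cite: KochNadirashviliSereginSverak2009, Prop. 4.1 (arXiv:0709.3599 p. 8)] -/
theorem isSmoothSpaceTimeOn_curl (hV : IsTypeIAncientMild C V) :
    IsSmoothSpaceTimeOn (Iio 0) (fun t x => curl (V t) x) := by
  have h : IsSmoothSpaceTimeOn (Iio 0) V := hV.contDiffOn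
  exact (h.fderiv_slice isOpen_Iio.uniqueDiffOn).clm_comp curlCLM

/-- `(t,x) ↦ curl curl (V t) x` is jointly smooth on the open past. [folklore] -/
theorem isSmoothSpaceTimeOn_curl_curl (hV : IsTypeIAncientMild C V) :
    IsSmoothSpaceTimeOn (Iio 0) (fun t x => curl (curl (V t)) x) :=
  ((isSmoothSpaceTimeOn_curl hV).fderiv_slice isOpen_Iio.uniqueDiffOn).clm_comp curlCLM

/-- `(t,x) ↦ V t x` is jointly continuous on `(−∞,0) × ℝ³`. [folklore] -/
theorem continuousOn_val (hV : IsTypeIAncientMild C V) :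
    ContinuousOn (fun p : ℝ × EuclideanSpace ℝ (Fin 3) => V p.1 p.2) (Iio 0 ×ˢ univ) :=
  hV.continuousOn_uncurry

/-- `(t,x) ↦ curl (V t) x` is jointly continuous on `(−∞,0) × ℝ³`. [folklore] -/
theorem continuousOn_curl (hV : IsTypeIAncientMild C V) :
    ContinuousOn (fun p : ℝ × EuclideanSpace ℝ (Fin 3) => curl (V p.1) p.2) (Iio 0 ×ˢ univ) :=
  (isSmoothSpaceTimeOn_curl hV).continuousOn

/-- `(t,x) ↦ curl curl (V t) x` is jointly continuous on `(−∞,0) × ℝ³`. [folklore] -/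
theorem continuousOn_curl_curl (hV : IsTypeIAncientMild C V) :
    ContinuousOn (fun p : ℝ × EuclideanSpace ℝ (Fin 3) => curl (curl (V p.1)) p.2) (Iio 0 ×ˢ univ) :=
  (isSmoothSpaceTimeOn_curl_curl hV).continuousOn

end Continuity

/-! ### The Lamb-form local balance at a point: scaling, limits, openness -/

section Bookkeeping

/-- **Pointwise scale covariance of the Lamb-form balance**: the balance for `V` at `(c²t, c x)`
is the balance for `V_c` at `(t, x)`. [folklore] -/
theorem localBalance_at_nsRescale (V : ℝ → EuclideanSpace ℝ (Fin 3) → EuclideanSpace ℝ (Fin 3))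
    {c t : ℝ} (x : EuclideanSpace ℝ (Fin 3)) (hc : 0 < c) (ht : t < 0)
    (h : ⟪V (c ^ 2 * t) (c • x), cross (curl (V (c ^ 2 * t)) (c • x)) (curl (curl (V (c ^ 2 * t))) (c • x))⟫ ≤
      ‖curl (curl (V (c ^ 2 * t))) (c • x)‖ ^ 2 + ‖curl (V (c ^ 2 * t)) (c • x)‖ ^ 2 / (4 * (-(c ^ 2 * t)))) :
    ⟪nsRescale c V t x, cross (curl (nsRescale c V t) x) (curl (curl (nsRescale c V t)) x)⟫ ≤
      ‖curl (curl (nsRescale c V t)) x‖ ^ 2 + ‖curl (nsRescale c V t) x‖ ^ 2 / (4 * (-t)) := by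
  -- adapted from `…LocalBalanceApex.localBalance_nsRescale_from` (pointwise form)
  have hcurl : curl (nsRescale c V t) x = (c * c) • curl (V (c ^ 2 * t)) (c • x) := by
    rw [curl_eq_curlCLM, fderiv_nsRescale, map_smul, ← curl_eq_curlCLM]
  rw [hcurl, curl_curl_nsRescale, nsRescale_apply, cross_smul_left, cross_smul_right,
    real_inner_smul_left, real_inner_smul_right, real_inner_smul_right, norm_smul, norm_smul,
    Real.norm_of_nonneg (by positivity : (0:ℝ) ≤ c * c),
    Real.norm_of_nonneg (by positivity : (0:ℝ) ≤ c * c * c)]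
  have ht' : 0 < -t := neg_pos.2 ht
  have h4 : (4 : ℝ) * (-t) ≠ 0 := by positivity
  have h4c : (4 : ℝ) * (-(c ^ 2 * t)) ≠ 0 := by
    rw [show (4 : ℝ) * (-(c ^ 2 * t)) = c ^ 2 * (4 * (-t)) by ring]; positivity
  have e1 : (c * c * ‖curl (V (c ^ 2 * t)) (c • x)‖) ^ 2 / (4 * (-t)) =
      c ^ 6 * (‖curl (V (c ^ 2 * t)) (c • x)‖ ^ 2 / (4 * (-(c ^ 2 * t)))) := by
    rw [mul_div_assoc', div_eq_div_iff h4 h4c]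
    ring
  have e : (c * c * c * ‖curl (curl (V (c ^ 2 * t))) (c • x)‖) ^ 2 +
      (c * c * ‖curl (V (c ^ 2 * t)) (c • x)‖) ^ 2 / (4 * (-t)) =
      c ^ 6 * (‖curl (curl (V (c ^ 2 * t))) (c • x)‖ ^ 2 +
        ‖curl (V (c ^ 2 * t)) (c • x)‖ ^ 2 / (4 * (-(c ^ 2 * t)))) := by
    rw [e1]
    ring
  rw [e]
  have hw : 0 ≤ c ^ 6 := by positivity
  calc c * (c * c * (c * c * c *
        ⟪V (c ^ 2 * t) (c • x), cross (curl (V (c ^ 2 * t)) (c • x)) (curl (curl (V (c ^ 2 * t))) (c • x))⟫))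
      = c ^ 6 * ⟪V (c ^ 2 * t) (c • x), cross (curl (V (c ^ 2 * t)) (c • x))
          (curl (curl (V (c ^ 2 * t))) (c • x))⟫ := by ring
    _ ≤ _ := mul_le_mul_of_nonneg_left h hw

/-- **Violations pass from KNSS limits to the approximants**: if `v_j → W` as in
`…Compactness.seqLimit` and the balance FAILS for `W` at `(t,x)`, `t < 0`, then it fails for `v_j`
at `(t,x)` for all large `j` (second vorticity derivatives converge, `…EndpointScheme`).
[cite: KochNadirashviliSereginSverak2009, Prop. 4.1 (arXiv:0709.3599 p. 8)] -/
theorem localBalance_violation_eventually {v : ℕ → ℝ → EuclideanSpace ℝ (Fin 3) → EuclideanSpace ℝ (Fin 3)}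
    {W : ℝ → EuclideanSpace ℝ (Fin 3) → EuclideanSpace ℝ (Fin 3)}
    (hv : ∀ j, IsTypeIAncientMild C (v j)) (hW : IsTypeIAncientMild C W)
    (hunif : ∀ n : ℕ, TendstoUniformlyOn (fun j z => v j z.1 z.2) (fun z => W z.1 z.2) atTop
      (Icc (-((n : ℝ) + 2)) (-(1 / ((n : ℝ) + 2))) ×ˢ
        closedBall (0 : EuclideanSpace ℝ (Fin 3)) ((n : ℝ) + 2)))
    (hpt : ∀ t < 0, ∀ x, Tendsto (fun j => v j t x) atTop (𝓝 (W t x)))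
    (hgr : ∀ t < 0, ∀ x, Tendsto (fun j => fderiv ℝ (v j t) x) atTop (𝓝 (fderiv ℝ (W t) x)))
    {t : ℝ} (ht : t < 0) (x : EuclideanSpace ℝ (Fin 3))
    (hbad : ¬ ⟪W t x, cross (curl (W t) x) (curl (curl (W t)) x)⟫ ≤
      ‖curl (curl (W t)) x‖ ^ 2 + ‖curl (W t) x‖ ^ 2 / (4 * (-t))) :
    ∀ᶠ j in atTop, ¬ ⟪v j t x, cross (curl (v j t) x) (curl (curl (v j t)) x)⟫ ≤
      ‖curl (curl (v j t)) x‖ ^ 2 + ‖curl (v j t) x‖ ^ 2 / (4 * (-t)) := by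
  have hta : Tendsto (fun j => v j t x) atTop (𝓝 (W t x)) := hpt t ht x
  have htb : Tendsto (fun j => curl (v j t) x) atTop (𝓝 (curl (W t) x)) :=
    tendsto_curl_of_fderiv (hgr t ht x)
  have htd : Tendsto (fun j => curl (curl (v j t)) x) atTop (𝓝 (curl (curl (W t)) x)) :=
    tendsto_curl_curl_of_unif hv hW hunif ht x
  have hcr : Tendsto (fun j => cross (curl (v j t) x) (curl (curl (v j t)) x)) atTop
      (𝓝 (cross (curl (W t) x) (curl (curl (W t)) x))) := by
    have h := ((crossCLM.continuous₂).tendsto (curl (W t) x, curl (curl (W t)) x)).comp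
      (htb.prodMk_nhds htd)
    refine h.congr fun j => ?_
    simp [Function.comp, crossCLM_apply]
  have hL : Tendsto (fun j => ⟪v j t x, cross (curl (v j t) x) (curl (curl (v j t)) x)⟫) atTop
      (𝓝 ⟪W t x, cross (curl (W t) x) (curl (curl (W t)) x)⟫) := hta.inner hcr
  have hR : Tendsto (fun j => ‖curl (curl (v j t)) x‖ ^ 2 + ‖curl (v j t) x‖ ^ 2 / (4 * (-t))) atTop
      (𝓝 (‖curl (curl (W t)) x‖ ^ 2 + ‖curl (W t) x‖ ^ 2 / (4 * (-t)))) :=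
    (htd.norm.pow 2).add ((htb.norm.pow 2).div_const _)
  rw [not_le] at hbad
  filter_upwards [hR.eventually_lt hL hbad] with j hj
  exact not_le.2 hj

/-- **The violation set of the Lamb-form balance is open** in `ℝ × ℝ³` (joint continuity of the
jet on the open past). [folklore] -/
theorem isOpen_localBalance_violation (hV : IsTypeIAncientMild C V) :
    IsOpen {p : ℝ × EuclideanSpace ℝ (Fin 3) | p.1 < 0 ∧
      ¬ ⟪V p.1 p.2, cross (curl (V p.1) p.2) (curl (curl (V p.1)) p.2)⟫ ≤
        ‖curl (curl (V p.1)) p.2‖ ^ 2 + ‖curl (V p.1) p.2‖ ^ 2 / (4 * (-p.1))} := by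
  have hS : IsOpen (Iio (0:ℝ) ×ˢ (univ : Set (EuclideanSpace ℝ (Fin 3)))) :=
    isOpen_Iio.prod isOpen_univ
  have ha := continuousOn_val hV
  have hb := continuousOn_curl hV
  have hd := continuousOn_curl_curl hV
  have hcr : ContinuousOn (fun p : ℝ × EuclideanSpace ℝ (Fin 3) =>
      cross (curl (V p.1) p.2) (curl (curl (V p.1)) p.2)) (Iio 0 ×ˢ univ) := by
    have h := crossCLM.continuous₂.comp_continuousOn (hb.prodMk hd)
    refine h.congr fun p _ => ?_
    simp [Function.comp, crossCLM_apply]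
  have hL : ContinuousOn (fun p : ℝ × EuclideanSpace ℝ (Fin 3) =>
      ⟪V p.1 p.2, cross (curl (V p.1) p.2) (curl (curl (V p.1)) p.2)⟫) (Iio 0 ×ˢ univ) :=
    ha.inner hcr
  have ht : ContinuousOn (fun p : ℝ × EuclideanSpace ℝ (Fin 3) => 4 * (-p.1)) (Iio 0 ×ˢ univ) :=
    (continuous_const.mul continuous_fst.neg).continuousOn
  have hR : ContinuousOn (fun p : ℝ × EuclideanSpace ℝ (Fin 3) =>
      ‖curl (curl (V p.1)) p.2‖ ^ 2 + ‖curl (V p.1) p.2‖ ^ 2 / (4 * (-p.1))) (Iio 0 ×ˢ univ) := by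
    refine (hd.norm.pow 2).add ((hb.norm.pow 2).div ht fun p hp => ?_)
    have : p.1 < 0 := hp.1
    exact mul_ne_zero four_ne_zero (neg_ne_zero.2 this.ne)
  have hO := (hL.sub hR).isOpen_inter_preimage hS (isOpen_Ioi (a := (0:ℝ)))
  convert hO using 1
  ext p
  simp only [mem_setOf_eq, mem_inter_iff, mem_prod, mem_Iio, mem_univ, and_true, mem_preimage,
    mem_Ioi, Pi.sub_apply, sub_pos, not_le]

end Bookkeeping

/-! ### Bounded gaps and definite volume of the local production excess -/

section Excess

/-- **THE LOCAL LAMB-FORM PRODUCTION EXCESS RECURS WITH BOUNDED GAPS.** For every `A` there is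
`ε = ε(A) ∈ (0,1)` such that every SINGULAR KNSS-gauge Type-I field (`IsTypeIAncientMild C V`,
`C ≤ A`) with a Type-I envelope `HasTypeIDecay A V` has in every window `[−c², −εc²]`, `c > 0`, a
point with `‖curl ω‖² + ‖ω‖²/(4(−t)) < ⟪V, ω × curl ω⟫`. [folklore energy method + KNSS compactness;
cite: KochNadirashviliSereginSverak2009, §4 (arXiv:0709.3599 p. 8)] -/
theorem localBalance_excess_in_every_window (A : ℝ) : ∃ ε : ℝ, 0 < ε ∧ ε < 1 ∧
    ∀ (C : ℝ) (V : ℝ → EuclideanSpace ℝ (Fin 3) → EuclideanSpace ℝ (Fin 3)),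
      IsTypeIAncientMild C V → C ≤ A → HasTypeIDecay A V →
      (∀ r > 0, ∀ M : ℝ, ∃ t ∈ Ioo (-(r ^ 2)) (0 : ℝ),
        ∃ x ∈ ball (0 : EuclideanSpace ℝ (Fin 3)) r, M < ‖V t x‖) →
      ∀ c : ℝ, 0 < c → ∃ t ∈ Icc (-c ^ 2) (-(ε * c ^ 2)), ∃ x : EuclideanSpace ℝ (Fin 3),
        ‖curl (curl (V t)) x‖ ^ 2 + ‖curl (V t) x‖ ^ 2 / (4 * (-t)) <
          ⟪V t x, cross (curl (V t) x) (curl (curl (V t)) x)⟫ := by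
  obtain ⟨ε, hε, hε1, h⟩ := exists_window_of_apex_kill_envelope (C := A)
    (G := fun F t x => ⟪F t x, cross (curl (F t) x) (curl (curl (F t)) x)⟫ ≤
      ‖curl (curl (F t)) x‖ ^ 2 + ‖curl (F t) x‖ ^ 2 / (4 * (-t)))
    (fun F c t x hc ht hG => localBalance_at_nsRescale F x hc ht hG)
    (fun u W hu hW hunif hpt hgr t ht x hbad =>
      localBalance_violation_eventually hu hW hunif hpt hgr ht x hbad)
    (fun W hW hdW hG => not_singular_of_localBalance_near_apex hW hdW (τ := -1/2) (by norm_num)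
      fun t h1 h2 x => hG t (by linarith) h2 x)
  refine ⟨ε, hε, hε1, fun C V hV hCA hdec hsing c hc => ?_⟩
  obtain ⟨t, ht, x, hx⟩ := h V (isTypeIAncientMild_of_le hV hCA) hdec hsing c hc
  exact ⟨t, ht, x, not_le.1 hx⟩

/-- **THE LOCAL LAMB-FORM PRODUCTION EXCESS FILLS A DEFINITE PARABOLIC VOLUME.** For every `A` there
are `ε = ε(A) ∈ (0,1)` and `η = η(A) > 0` such that for every SINGULAR KNSS-gauge Type-I field
(`IsTypeIAncientMild C V`, `C ≤ A`) with a Type-I envelope `HasTypeIDecay A V`, the set of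
`(t, x) ∈ [−1, −ε] × ℝ³` with `‖curl ω‖² + ‖ω‖²/(4(−t)) < ⟪V, ω × curl ω⟫` has space–time volume
`≥ η` (apply to `V_c` for the window `[−c², −εc²]`). [folklore energy method + KNSS compactness;
cite: KochNadirashviliSereginSverak2009, §4 (arXiv:0709.3599 p. 8)] -/
theorem localBalance_excess_volume (A : ℝ) : ∃ ε : ℝ, 0 < ε ∧ ε < 1 ∧ ∃ η : ℝ, 0 < η ∧
    ∀ (C : ℝ) (V : ℝ → EuclideanSpace ℝ (Fin 3) → EuclideanSpace ℝ (Fin 3)),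
      IsTypeIAncientMild C V → C ≤ A → HasTypeIDecay A V →
      (∀ r > 0, ∀ M : ℝ, ∃ t ∈ Ioo (-(r ^ 2)) (0 : ℝ),
        ∃ x ∈ ball (0 : EuclideanSpace ℝ (Fin 3)) r, M < ‖V t x‖) →
      ENNReal.ofReal η ≤ volume {p : ℝ × EuclideanSpace ℝ (Fin 3) | p.1 ∈ Icc (-1 : ℝ) (-ε) ∧
        ‖curl (curl (V p.1)) p.2‖ ^ 2 + ‖curl (V p.1) p.2‖ ^ 2 / (4 * (-p.1)) <
          ⟪V p.1 p.2, cross (curl (V p.1) p.2) (curl (curl (V p.1)) p.2)⟫} := by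
  obtain ⟨ε, hε, hε1, η, hη, h⟩ := exists_window_volume_of_apex_kill_envelope (C := A)
    (G := fun F t x => ⟪F t x, cross (curl (F t) x) (curl (curl (F t)) x)⟫ ≤
      ‖curl (curl (F t)) x‖ ^ 2 + ‖curl (F t) x‖ ^ 2 / (4 * (-t)))
    (fun u W hu hW hunif hpt hgr t ht x hbad =>
      localBalance_violation_eventually hu hW hunif hpt hgr ht x hbad)
    (fun U hU _ => isOpen_localBalance_violation hU)
    (fun W hW hdW hG => not_singular_of_localBalance_near_apex hW hdW (τ := -1/2) (by norm_num)
      fun t h1 h2 x => hG t (by linarith) h2 x)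
  refine ⟨ε, hε, hε1, η, hη, fun C V hV hCA hdec hsing => ?_⟩
  have h1 := h V (isTypeIAncientMild_of_le hV hCA) hdec hsing
  refine h1.trans (measure_mono fun p hp => ⟨hp.1, not_le.1 hp.2⟩)

end Excess

/-! ### Corollaries: product bound, cross-flow, threshold one -/

section Corollaries

/-- Pointwise: speed `√(−t)‖u‖ ≤ 1` gives the product bound `√(−t)⟪u, ω × curl ω⟫ ≤ ‖ω‖‖curl ω‖`.
[folklore] -/
theorem lambProduct_at_of_speed_le_one {t : ℝ} {u Ω Λ : EuclideanSpace ℝ (Fin 3)}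
    (h : Real.sqrt (-t) * ‖u‖ ≤ 1) : Real.sqrt (-t) * ⟪u, cross Ω Λ⟫ ≤ ‖Ω‖ * ‖Λ‖ := by
  have hs : 0 ≤ Real.sqrt (-t) := Real.sqrt_nonneg _
  have hU : ‖Real.sqrt (-t) • u‖ ≤ 1 := by rw [norm_smul, Real.norm_of_nonneg hs]; exact h
  have h2 := lambProduct_of_norm_le_one hU Ω Λ
  rwa [real_inner_smul_left] at h2

/-- Pointwise: cross-flow `√(−t)‖ω × u‖ ≤ ‖ω‖` gives the product bound. [folklore] -/
theorem lambProduct_at_of_crossFlow_le {t : ℝ} {u Ω Λ : EuclideanSpace ℝ (Fin 3)}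
    (h : Real.sqrt (-t) * ‖cross Ω u‖ ≤ ‖Ω‖) : Real.sqrt (-t) * ⟪u, cross Ω Λ⟫ ≤ ‖Ω‖ * ‖Λ‖ := by
  have hs : 0 ≤ Real.sqrt (-t) := Real.sqrt_nonneg _
  have hc : ‖cross Ω (Real.sqrt (-t) • u)‖ ≤ ‖Ω‖ := by
    rw [cross_smul_right, norm_smul, Real.norm_of_nonneg hs]; exact h
  have h2 := lambProduct_of_crossFlow_le hc Λ
  rwa [real_inner_smul_left] at h2

/-- Pointwise: the product bound gives the Lamb-form balance (`ab ≤ √(−t)(b² + a²/(4(−t)))`).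
[folklore] -/
theorem localBalance_at_of_lambProduct {t : ℝ} (ht : t < 0) {u Ω Λ : EuclideanSpace ℝ (Fin 3)}
    (h : Real.sqrt (-t) * ⟪u, cross Ω Λ⟫ ≤ ‖Ω‖ * ‖Λ‖) :
    ⟪u, cross Ω Λ⟫ ≤ ‖Λ‖ ^ 2 + ‖Ω‖ ^ 2 / (4 * (-t)) := by
  -- adapted from `…LocalBalanceApex.not_singular_of_lambProduct_near_apex`
  have ht' : 0 < -t := neg_pos.2 ht
  set r : ℝ := Real.sqrt (-t) with hr
  have hs : 0 < r := Real.sqrt_pos.2 ht'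
  have hss : r * r = -t := Real.mul_self_sqrt ht'.le
  have h2 : ‖Ω‖ * ‖Λ‖ ≤ r * (‖Λ‖ ^ 2 + ‖Ω‖ ^ 2 / (4 * (-t))) := by
    rw [← hss]
    set a : ℝ := ‖Ω‖
    set b : ℝ := ‖Λ‖
    have e : r * (b ^ 2 + a ^ 2 / (4 * (r * r))) = (4 * r ^ 2 * b ^ 2 + a ^ 2) / (4 * r) := by
      rw [eq_div_iff (by positivity)]
      field_simp
    rw [e, le_div_iff₀ (by positivity)]
    nlinarith [sq_nonneg (2 * r * b - a)]
  exact le_of_mul_le_mul_left (h.trans h2) hs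

/-- **THE SUPER-SELF-SIMILAR SPEED RECURS WITH BOUNDED GAPS.** With `ε(A)` of
`localBalance_excess_in_every_window`: every singular enveloped member has in every window
`[−c², −εc²]` a point with `1 < √(−t)‖V(t,x)‖` — the fast set is never empty for more than
`|log ε(A)|` e-folds of backward time, at any scale. [folklore; cite: KochNadirashviliSereginSverak2009, §4 (arXiv:0709.3599 p. 8)] -/
theorem speed_exceeds_one_in_every_window (A : ℝ) : ∃ ε : ℝ, 0 < ε ∧ ε < 1 ∧
    ∀ (C : ℝ) (V : ℝ → EuclideanSpace ℝ (Fin 3) → EuclideanSpace ℝ (Fin 3)),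
      IsTypeIAncientMild C V → C ≤ A → HasTypeIDecay A V →
      (∀ r > 0, ∀ M : ℝ, ∃ t ∈ Ioo (-(r ^ 2)) (0 : ℝ),
        ∃ x ∈ ball (0 : EuclideanSpace ℝ (Fin 3)) r, M < ‖V t x‖) →
      ∀ c : ℝ, 0 < c → ∃ t ∈ Icc (-c ^ 2) (-(ε * c ^ 2)), ∃ x : EuclideanSpace ℝ (Fin 3),
        1 < Real.sqrt (-t) * ‖V t x‖ := by
  obtain ⟨ε, hε, hε1, h⟩ := localBalance_excess_in_every_window A
  refine ⟨ε, hε, hε1, fun C V hV hCA hdec hsing c hc => ?_⟩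
  obtain ⟨t, ht, x, hx⟩ := h C V hV hCA hdec hsing c hc
  have ht0 : t < 0 := by
    have : 0 < ε * c ^ 2 := by positivity
    linarith [ht.2]
  refine ⟨t, ht, x, ?_⟩
  by_contra hle
  exact (not_le.2 hx) (localBalance_at_of_lambProduct ht0 (lambProduct_at_of_speed_le_one (not_lt.1 hle)))

/-- **THE PRODUCT BOUND FAILS IN EVERY WINDOW**: a point with `‖ω‖‖curl ω‖ < √(−t)⟪V, ω × curl ω⟫`
in every `[−c², −εc²]`. [folklore] -/
theorem lambProduct_excess_in_every_window (A : ℝ) : ∃ ε : ℝ, 0 < ε ∧ ε < 1 ∧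
    ∀ (C : ℝ) (V : ℝ → EuclideanSpace ℝ (Fin 3) → EuclideanSpace ℝ (Fin 3)),
      IsTypeIAncientMild C V → C ≤ A → HasTypeIDecay A V →
      (∀ r > 0, ∀ M : ℝ, ∃ t ∈ Ioo (-(r ^ 2)) (0 : ℝ),
        ∃ x ∈ ball (0 : EuclideanSpace ℝ (Fin 3)) r, M < ‖V t x‖) →
      ∀ c : ℝ, 0 < c → ∃ t ∈ Icc (-c ^ 2) (-(ε * c ^ 2)), ∃ x : EuclideanSpace ℝ (Fin 3),
        ‖curl (V t) x‖ * ‖curl (curl (V t)) x‖ <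
          Real.sqrt (-t) * ⟪V t x, cross (curl (V t) x) (curl (curl (V t)) x)⟫ := by
  obtain ⟨ε, hε, hε1, h⟩ := localBalance_excess_in_every_window A
  refine ⟨ε, hε, hε1, fun C V hV hCA hdec hsing c hc => ?_⟩
  obtain ⟨t, ht, x, hx⟩ := h C V hV hCA hdec hsing c hc
  have ht0 : t < 0 := by
    have : 0 < ε * c ^ 2 := by positivity
    linarith [ht.2]
  refine ⟨t, ht, x, ?_⟩
  by_contra hle
  exact (not_le.2 hx) (localBalance_at_of_lambProduct ht0 (not_lt.1 hle))

/-- **THE CROSS-FLOW BOUND FAILS IN EVERY WINDOW**: a point with `‖ω‖ < √(−t)‖ω × V‖`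
in every `[−c², −εc²]`. [folklore] -/
theorem crossFlow_excess_in_every_window (A : ℝ) : ∃ ε : ℝ, 0 < ε ∧ ε < 1 ∧
    ∀ (C : ℝ) (V : ℝ → EuclideanSpace ℝ (Fin 3) → EuclideanSpace ℝ (Fin 3)),
      IsTypeIAncientMild C V → C ≤ A → HasTypeIDecay A V →
      (∀ r > 0, ∀ M : ℝ, ∃ t ∈ Ioo (-(r ^ 2)) (0 : ℝ),
        ∃ x ∈ ball (0 : EuclideanSpace ℝ (Fin 3)) r, M < ‖V t x‖) →
      ∀ c : ℝ, 0 < c → ∃ t ∈ Icc (-c ^ 2) (-(ε * c ^ 2)), ∃ x : EuclideanSpace ℝ (Fin 3),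
        ‖curl (V t) x‖ < Real.sqrt (-t) * ‖cross (curl (V t) x) (V t x)‖ := by
  obtain ⟨ε, hε, hε1, h⟩ := lambProduct_excess_in_every_window A
  refine ⟨ε, hε, hε1, fun C V hV hCA hdec hsing c hc => ?_⟩
  obtain ⟨t, ht, x, hx⟩ := h C V hV hCA hdec hsing c hc
  refine ⟨t, ht, x, ?_⟩
  by_contra hle
  exact (not_le.2 hx) (lambProduct_at_of_crossFlow_le (not_lt.1 hle))

/-- **THE FAST SET FILLS A DEFINITE PARABOLIC VOLUME.** With `ε(A)`, `η(A)` of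
`localBalance_excess_volume`: for every singular enveloped member the set
`{(t,x) ∈ [−1,−ε] × ℝ³ : √(−t)‖V(t,x)‖ > 1}` has space–time volume `≥ η` (and, applying this to
`V_c`, volume `≥ η c⁵` in `[−c², −εc²] × ℝ³`). [folklore; cite: KochNadirashviliSereginSverak2009, §4 (arXiv:0709.3599 p. 8)] -/
theorem speed_exceeds_one_volume (A : ℝ) : ∃ ε : ℝ, 0 < ε ∧ ε < 1 ∧ ∃ η : ℝ, 0 < η ∧
    ∀ (C : ℝ) (V : ℝ → EuclideanSpace ℝ (Fin 3) → EuclideanSpace ℝ (Fin 3)),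
      IsTypeIAncientMild C V → C ≤ A → HasTypeIDecay A V →
      (∀ r > 0, ∀ M : ℝ, ∃ t ∈ Ioo (-(r ^ 2)) (0 : ℝ),
        ∃ x ∈ ball (0 : EuclideanSpace ℝ (Fin 3)) r, M < ‖V t x‖) →
      ENNReal.ofReal η ≤ volume {p : ℝ × EuclideanSpace ℝ (Fin 3) | p.1 ∈ Icc (-1 : ℝ) (-ε) ∧
        1 < Real.sqrt (-p.1) * ‖V p.1 p.2‖} := by
  obtain ⟨ε, hε, hε1, η, hη, h⟩ := localBalance_excess_volume A
  refine ⟨ε, hε, hε1, η, hη, fun C V hV hCA hdec hsing => ?_⟩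
  refine (h C V hV hCA hdec hsing).trans (measure_mono fun p hp => ⟨hp.1, ?_⟩)
  have ht0 : p.1 < 0 := by linarith [hp.1.2]
  by_contra hle
  exact (not_le.2 hp.2)
    (localBalance_at_of_lambProduct ht0 (lambProduct_at_of_speed_le_one (not_lt.1 hle)))

end Corollaries

end Summit.NavierStokesRegularity.NavierStokesRegularity.Theorems.FiniteDissipationLiouville.WindowRecurrence

end
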